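import Literature.Analysis.FluidPDE.PassiveScalarClassicalEnergy
import Literature.Analysis.FunctionSpaces.TorusTrigPoly
import HarnessLib

/-!
# Viscous–inviscid comparison for classical passive scalars (Drivas–Elgindi–Iyer–Jeong, §2.1)

Analysis/FluidPDE proof-support file for the discharge of
`Literature.Analysis.FluidPDE.deij_anomalous_dissipation` (`TurbPassiveScalar`); everything here
is proved.

Let `u` be a smooth divergence-free velocity field on a time set `S ⊇ [a, b]`, let `θ` be a
classical solution of the advection–diffusion equation `∂ₜθ + u·∇θ = κΔθ` (`κ ≥ 0`) and `ϑ` a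
classical solution of the transport equation `∂ₜϑ + u·∇ϑ = 0` on `S × T^d`. The first display
of the proof of Prop. 1.3 of Drivas–Elgindi–Iyer–Jeong (Arch. Ration. Mech. Anal. 243 (2022),
§2.1) is the balance

  `½ d/dt ‖ϑ - θ‖²_{L²} = κ ∫ Δθ (θ - ϑ) = -κ‖∇θ‖²_{L²} + κ ∫ ∇θ·∇ϑ`

(the transport term drops out by incompressibility). We prove it
(`hasDerivWithinAt_scalarL2Sq_sub`) and record two integrated consequences:

* `scalarL2Sq_sub_le_add_half_scalarDissipation` — since
  `-‖∇θ‖² + ∇θ·∇ϑ ≤ ¼‖∇ϑ‖²` pointwise, `‖θ(b) - ϑ(b)‖² ≤ ‖θ(a) - ϑ(a)‖² + ½ κ∫ₐᵇ‖∇ϑ‖²`: the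
  viscous solution stays `L²`-close to the inviscid one as long as the *inviscid* cumulative
  dissipation `κ∫‖∇ϑ‖²` is small (the form used in the discharge of DEIJ Thm. 2);
* `scalarL2Sq_sub_le_of_forall_pos` — the weighted form
  `‖θ(b) - ϑ(b)‖² ≤ ‖θ(a) - ϑ(a)‖² + λ κ∫ₐᵇ‖∇ϑ‖² + λ⁻¹ κ∫ₐᵇ‖∇θ‖²` for every `λ > 0`, whose
  optimisation in `λ` is DEIJ's
  `½‖θ - ϑ‖²(t) ≤ (κ∫₀ᵗ‖∇θ‖²)^{1/2} (κ∫₀ᵗ‖∇ϑ‖²)^{1/2}` (equal data) up to the constant.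

All norms are the derivative-based functionals `Torus.scalarL2Sq`, `Torus.scalarGradNormSq`,
`Torus.scalarDissipation` of `PassiveScalar`; the time derivative is one-sided within `[a, b]`
as in `Torus.IsClassicalScalarTransportOn`. Proof: differentiate `∫ (θ - ϑ)²` under the
integral sign (`Torus.IsSmoothSpaceTimeOn.hasDerivWithinAt_integral`), insert the two equations,
kill the transport term (`Torus.integral_mul_inner_gradient_self_eq_zero`), integrate by parts
(`Torus.integral_mul_laplacian_eq_neg_sum`), and integrate in time (fundamental theorem of
calculus, continuity of all space integrals of jointly smooth fields).

## References

* T. D. Drivas, T. M. Elgindi, G. Iyer, I.-J. Jeong, *Anomalous dissipation in passive scalar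
  transport*, Arch. Ration. Mech. Anal. 243 (2022), 1151–1180, §2.1, proof of Prop. 1.3, first
  display. [DrivasEtAl2022]
-/

open MeasureTheory Set Filter
open _root_.Topology
open scoped InnerProductSpace ContDiff ENNReal NNReal

noncomputable section

namespace Literature.Analysis.FluidPDE

namespace Torus

variable {d : Type*} [Fintype d] [DecidableEq d]

/-! ## Pointwise algebra -/

omit [Fintype d] [DecidableEq d] in
/-- `a b - b² ≤ a²/4` (complete the square). [folklore] -/
theorem mul_sub_sq_le_sq_div_four (a b : ℝ) : a * b - b ^ 2 ≤ a ^ 2 / 4 := by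
  nlinarith [sq_nonneg (a / 2 - b)]

omit [Fintype d] [DecidableEq d] in
/-- `a b ≤ (λ a² + λ⁻¹ b²)/2` for `λ > 0` (weighted arithmetic–geometric mean). [folklore] -/
theorem mul_le_weighted_sq_add_sq {l : ℝ} (hl : 0 < l) (a b : ℝ) :
    a * b ≤ (l * a ^ 2 + l⁻¹ * b ^ 2) / 2 := by
  have h : 0 ≤ (l * a - b) ^ 2 / l := div_nonneg (sq_nonneg _) hl.le
  have e : (l * a - b) ^ 2 / l = l * a ^ 2 - 2 * (a * b) + l⁻¹ * b ^ 2 := by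
    field_simp
    ring
  rw [e] at h
  linarith

/-- Partial derivatives of a difference of smooth functions (pointwise-lambda form). [folklore] -/
theorem partialDeriv_fun_sub {F : Type*} [NormedAddCommGroup F] [NormedSpace ℝ F]
    {f g : UnitAddTorus d → F} (hf : FunctionSpaces.Torus.IsSmooth f) (hg : FunctionSpaces.Torus.IsSmooth g)
    (j : d) (x : UnitAddTorus d) :
    FunctionSpaces.Torus.partialDeriv j (fun y => f y - g y) x =
      FunctionSpaces.Torus.partialDeriv j f x - FunctionSpaces.Torus.partialDeriv j g x :=
  ((hf.hasDerivAt_line_zero j x).sub (hg.hasDerivAt_line_zero j x)).deriv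

/-- `⟪v, ∇(f - g)⟫ = ⟪v, ∇f⟫ - ⟪v, ∇g⟫` for smooth scalars on the torus. [folklore] -/
theorem inner_gradient_fun_sub {f g : UnitAddTorus d → ℝ} (hf : FunctionSpaces.Torus.IsSmooth f)
    (hg : FunctionSpaces.Torus.IsSmooth g) (v : EuclideanSpace ℝ d) (x : UnitAddTorus d) :
    ⟪v, FunctionSpaces.Torus.gradient (fun y => f y - g y) x⟫_ℝ =
      ⟪v, FunctionSpaces.Torus.gradient f x⟫_ℝ - ⟪v, FunctionSpaces.Torus.gradient g x⟫_ℝ := by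
  have hfg : FunctionSpaces.Torus.IsSmooth (fun y => f y - g y) := hf.sub hg
  rw [FunctionSpaces.Torus.inner_gradient_eq_sum_mul_partialDeriv (hfg.isContDiff (by simp)),
    FunctionSpaces.Torus.inner_gradient_eq_sum_mul_partialDeriv (hf.isContDiff (by simp)),
    FunctionSpaces.Torus.inner_gradient_eq_sum_mul_partialDeriv (hg.isContDiff (by simp)),
    ← Finset.sum_sub_distrib]
  refine Finset.sum_congr rfl fun j _ => ?_
  rw [partialDeriv_fun_sub hf hg, mul_sub]

/-! ## The comparison balance -/

namespace IsClassicalScalarTransportOn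

variable {S : Set ℝ} {κ : ℝ} {u : ℝ → UnitAddTorus d → EuclideanSpace ℝ d}
  {θ ϑ : ℝ → UnitAddTorus d → ℝ}

/-- **The viscous–inviscid balance** (DEIJ 2022, §2.1, first display of the proof of
Prop. 1.3). For a classical solution `θ` of `∂ₜθ + u·∇θ = κΔθ` and a classical solution `ϑ` of
`∂ₜϑ + u·∇ϑ = 0` on a convex time set `S` (same smooth divergence-free `u`),
`d/dt ‖θ(t) - ϑ(t)‖²_{L²} = 2κ (∑ᵢ ∫ ∂ᵢϑ ∂ᵢθ - ‖∇θ(t)‖²_{L²})` within `S`: the transport term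
`∫ (θ-ϑ) u·∇(θ-ϑ)` vanishes by incompressibility and `∫ (θ-ϑ) Δθ = -‖∇θ‖² + ∫ ∇ϑ·∇θ`.
[cite: DrivasEtAl2022, §2.1, proof of Prop. 1.3, first display] -/
theorem hasDerivWithinAt_scalarL2Sq_sub (hθ : IsClassicalScalarTransportOn S κ u θ)
    (hϑ : IsClassicalScalarTransportOn S 0 u ϑ) (hS : Convex ℝ S) {t : ℝ} (ht : t ∈ S) :
    HasDerivWithinAt (fun s => scalarL2Sq (fun x => θ s x - ϑ s x))
      (2 * κ * ((∑ i, ∫ x, FunctionSpaces.Torus.partialDeriv i (ϑ t) x *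
          FunctionSpaces.Torus.partialDeriv i (θ t) x) - scalarGradNormSq (θ t))) S t := by
  by_cases hacc : AccPt t (𝓟 S)
  swap
  · exact HasFDerivWithinAt.of_not_accPt hacc
  have hU : UniqueDiffOn ℝ S :=
    uniqueDiffOn_convex hS (FunctionSpaces.Torus.interior_nonempty_of_convex_of_accPt hS ht hacc)
  set δ : ℝ → UnitAddTorus d → ℝ := fun s x => θ s x - ϑ s x with hδ
  have hδs : FunctionSpaces.Torus.IsSmoothSpaceTimeOn S δ := hθ.smooth_scalar.sub hϑ.smooth_scalar
  have hθt : FunctionSpaces.Torus.IsSmooth (θ t) := hθ.smooth_scalar.isSmooth_slice ht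
  have hϑt : FunctionSpaces.Torus.IsSmooth (ϑ t) := hϑ.smooth_scalar.isSmooth_slice ht
  have hδt : FunctionSpaces.Torus.IsSmooth (δ t) := hδs.isSmooth_slice ht
  have hut : FunctionSpaces.Torus.IsSmooth (u t) := hθ.smooth_velocity.isSmooth_slice ht
  -- differentiate `∫ δ²` under the integral sign
  have hφ : FunctionSpaces.Torus.IsSmoothSpaceTimeOn S (fun s x => δ s x * δ s x) := hδs.mul hδs
  have hE := hφ.hasDerivWithinAt_integral hS ht
  have hfun : (fun s => scalarL2Sq (fun x => θ s x - ϑ s x)) = fun s => ∫ x, δ s x * δ s x := by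
    funext s
    simp only [scalarL2Sq, sq, hδ]
  rw [hfun]
  refine hE.congr_deriv ?_
  -- the time derivative of `δ²` and of `δ`
  have hdδ : ∀ x, FunctionSpaces.Torus.timeDerivWithin S δ t x =
      κ * FunctionSpaces.Torus.laplacian (θ t) x - ⟪u t x, FunctionSpaces.Torus.gradient (δ t) x⟫_ℝ := by
    intro x
    have hsub : FunctionSpaces.Torus.timeDerivWithin S δ t x =
        FunctionSpaces.Torus.timeDerivWithin S θ t x - FunctionSpaces.Torus.timeDerivWithin S ϑ t x :=
      ((hθ.smooth_scalar.hasDerivWithinAt_slice ht x).sub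
        (hϑ.smooth_scalar.hasDerivWithinAt_slice ht x)).derivWithin (hU t ht)
    have e1 := hθ.transport t ht x
    have e2 := hϑ.transport t ht x
    have hgrad : ⟪u t x, FunctionSpaces.Torus.gradient (δ t) x⟫_ℝ =
        ⟪u t x, FunctionSpaces.Torus.gradient (θ t) x⟫_ℝ - ⟪u t x, FunctionSpaces.Torus.gradient (ϑ t) x⟫_ℝ :=
      inner_gradient_fun_sub hθt hϑt (u t x) x
    rw [hsub, hgrad]
    linear_combination e1 - e2
  have htd : ∀ x, FunctionSpaces.Torus.timeDerivWithin S (fun s x => δ s x * δ s x) t x =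
      2 * (κ * (δ t x * FunctionSpaces.Torus.laplacian (θ t) x) -
        δ t x * ⟪u t x, FunctionSpaces.Torus.gradient (δ t) x⟫_ℝ) := by
    intro x
    have h2 : HasDerivWithinAt (fun τ => δ τ x * δ τ x)
        (FunctionSpaces.Torus.timeDerivWithin S δ t x * δ t x +
          δ t x * FunctionSpaces.Torus.timeDerivWithin S δ t x) S t :=
      (hδs.hasDerivWithinAt_slice ht x).mul (hδs.hasDerivWithinAt_slice ht x)
    rw [FunctionSpaces.Torus.timeDerivWithin, h2.derivWithin (hU t ht),
      show FunctionSpaces.Torus.timeDerivWithin S δ t x = _ from hdδ x]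
    ring
  have i1 : Integrable (fun x => δ t x * FunctionSpaces.Torus.laplacian (θ t) x) volume :=
    (hδt.smul' hθt.laplacian).integrable
  have i2 : Integrable (fun x => δ t x * ⟪u t x, FunctionSpaces.Torus.gradient (δ t) x⟫_ℝ) volume :=
    (hδt.smul' (hut.inner hδt.gradient)).integrable
  -- `∫ δ Δθ = -‖∇θ‖² + ∑ᵢ ∫ ∂ᵢϑ ∂ᵢθ`
  have hlap : ∫ x, δ t x * FunctionSpaces.Torus.laplacian (θ t) x =
      (∑ i, ∫ x, FunctionSpaces.Torus.partialDeriv i (ϑ t) x * FunctionSpaces.Torus.partialDeriv i (θ t) x) -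
        scalarGradNormSq (θ t) := by
    have hsplit : (fun x => δ t x * FunctionSpaces.Torus.laplacian (θ t) x) =
        fun x => θ t x * FunctionSpaces.Torus.laplacian (θ t) x - ϑ t x * FunctionSpaces.Torus.laplacian (θ t) x := by
      funext x
      simp only [hδ]
      ring
    have j1 : Integrable (fun x => θ t x * FunctionSpaces.Torus.laplacian (θ t) x) volume :=
      (hθt.smul' hθt.laplacian).integrable
    have j2 : Integrable (fun x => ϑ t x * FunctionSpaces.Torus.laplacian (θ t) x) volume :=
      (hϑt.smul' hθt.laplacian).integrable
    rw [hsplit, integral_sub j1 j2, integral_mul_laplacian_self_eq_neg_scalarGradNormSq hθt,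
      FunctionSpaces.Torus.integral_mul_laplacian_eq_neg_sum hϑt hθt]
    ring
  rw [show (fun x => FunctionSpaces.Torus.timeDerivWithin S (fun s x => δ s x * δ s x) t x) =
      fun x => 2 * (κ * (δ t x * FunctionSpaces.Torus.laplacian (θ t) x) -
        δ t x * ⟪u t x, FunctionSpaces.Torus.gradient (δ t) x⟫_ℝ) from funext htd,
    integral_const_mul, integral_sub (i1.const_mul κ) i2, integral_const_mul,
    integral_mul_inner_gradient_self_eq_zero hut (hθ.divFree t ht) hδt, hlap]
  ring

/-- The right-hand side of the viscous–inviscid balance is at most `½ κ ‖∇ϑ(t)‖²_{L²}` for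
`κ ≥ 0`: pointwise `∂ᵢϑ ∂ᵢθ - (∂ᵢθ)² ≤ (∂ᵢϑ)²/4`. [folklore] -/
theorem two_mul_mul_sum_integral_sub_le (hθ : IsClassicalScalarTransportOn S κ u θ)
    (hϑ : IsClassicalScalarTransportOn S 0 u ϑ) (hκ : 0 ≤ κ) {t : ℝ} (ht : t ∈ S) :
    2 * κ * ((∑ i, ∫ x, FunctionSpaces.Torus.partialDeriv i (ϑ t) x *
          FunctionSpaces.Torus.partialDeriv i (θ t) x) - scalarGradNormSq (θ t)) ≤
      κ / 2 * scalarGradNormSq (ϑ t) := by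
  have hθt : FunctionSpaces.Torus.IsSmooth (θ t) := hθ.smooth_scalar.isSmooth_slice ht
  have hϑt : FunctionSpaces.Torus.IsSmooth (ϑ t) := hϑ.smooth_scalar.isSmooth_slice ht
  rw [scalarGradNormSq_eq_sum_integral hθt, scalarGradNormSq_eq_sum_integral hϑt, ← Finset.sum_sub_distrib,
    Finset.mul_sum, Finset.mul_sum]
  refine Finset.sum_le_sum fun i _ => ?_
  have iP : Integrable (fun x => FunctionSpaces.Torus.partialDeriv i (ϑ t) x *
      FunctionSpaces.Torus.partialDeriv i (θ t) x) volume :=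
    ((hϑt.partialDeriv i).continuous.mul (hθt.partialDeriv i).continuous).integrable_unitAddTorus
  have iθ : Integrable (fun x => FunctionSpaces.Torus.partialDeriv i (θ t) x ^ 2) volume :=
    ((hθt.partialDeriv i).continuous.pow 2).integrable_unitAddTorus
  have iϑ : Integrable (fun x => FunctionSpaces.Torus.partialDeriv i (ϑ t) x ^ 2) volume :=
    ((hϑt.partialDeriv i).continuous.pow 2).integrable_unitAddTorus
  rw [← integral_sub iP iθ]
  have hmono : ∫ x, (FunctionSpaces.Torus.partialDeriv i (ϑ t) x * FunctionSpaces.Torus.partialDeriv i (θ t) x -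
      FunctionSpaces.Torus.partialDeriv i (θ t) x ^ 2) ≤
      ∫ x, FunctionSpaces.Torus.partialDeriv i (ϑ t) x ^ 2 / 4 :=
    integral_mono (iP.sub iθ) (iϑ.div_const 4) fun x => mul_sub_sq_le_sq_div_four _ _
  rw [integral_div] at hmono
  have h0 : 0 ≤ ∫ x, FunctionSpaces.Torus.partialDeriv i (ϑ t) x ^ 2 := integral_nonneg fun x => sq_nonneg _
  nlinarith [hmono, h0]

/-- The right-hand side of the viscous–inviscid balance is at most
`λ κ‖∇ϑ(t)‖² + λ⁻¹ κ‖∇θ(t)‖²` for `κ ≥ 0`, `λ > 0` (weighted arithmetic–geometric mean on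
`∂ᵢϑ ∂ᵢθ`, and `-2κ‖∇θ‖² ≤ 0`). [folklore] -/
theorem two_mul_mul_sum_integral_sub_le_weighted (hθ : IsClassicalScalarTransportOn S κ u θ)
    (hϑ : IsClassicalScalarTransportOn S 0 u ϑ) (hκ : 0 ≤ κ) {l : ℝ} (hl : 0 < l) {t : ℝ} (ht : t ∈ S) :
    2 * κ * ((∑ i, ∫ x, FunctionSpaces.Torus.partialDeriv i (ϑ t) x *
          FunctionSpaces.Torus.partialDeriv i (θ t) x) - scalarGradNormSq (θ t)) ≤
      κ * (l * scalarGradNormSq (ϑ t) + l⁻¹ * scalarGradNormSq (θ t)) := by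
  have hθt : FunctionSpaces.Torus.IsSmooth (θ t) := hθ.smooth_scalar.isSmooth_slice ht
  have hϑt : FunctionSpaces.Torus.IsSmooth (ϑ t) := hϑ.smooth_scalar.isSmooth_slice ht
  have hG : 0 ≤ scalarGradNormSq (θ t) := scalarGradNormSq_nonneg _
  have hP : (∑ i, ∫ x, FunctionSpaces.Torus.partialDeriv i (ϑ t) x * FunctionSpaces.Torus.partialDeriv i (θ t) x) ≤
      (l * scalarGradNormSq (ϑ t) + l⁻¹ * scalarGradNormSq (θ t)) / 2 := by
    rw [scalarGradNormSq_eq_sum_integral hθt, scalarGradNormSq_eq_sum_integral hϑt, Finset.mul_sum,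
      Finset.mul_sum, ← Finset.sum_add_distrib, Finset.sum_div]
    refine Finset.sum_le_sum fun i _ => ?_
    have iP : Integrable (fun x => FunctionSpaces.Torus.partialDeriv i (ϑ t) x *
        FunctionSpaces.Torus.partialDeriv i (θ t) x) volume :=
      ((hϑt.partialDeriv i).continuous.mul (hθt.partialDeriv i).continuous).integrable_unitAddTorus
    have iθ : Integrable (fun x => FunctionSpaces.Torus.partialDeriv i (θ t) x ^ 2) volume :=
      ((hθt.partialDeriv i).continuous.pow 2).integrable_unitAddTorus
    have iϑ : Integrable (fun x => FunctionSpaces.Torus.partialDeriv i (ϑ t) x ^ 2) volume :=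
      ((hϑt.partialDeriv i).continuous.pow 2).integrable_unitAddTorus
    have iR : Integrable (fun x => (l * FunctionSpaces.Torus.partialDeriv i (ϑ t) x ^ 2 +
        l⁻¹ * FunctionSpaces.Torus.partialDeriv i (θ t) x ^ 2) / 2) volume :=
      ((iϑ.const_mul l).add (iθ.const_mul l⁻¹)).div_const 2
    have hmono : ∫ x, FunctionSpaces.Torus.partialDeriv i (ϑ t) x * FunctionSpaces.Torus.partialDeriv i (θ t) x ≤
        ∫ x, (l * FunctionSpaces.Torus.partialDeriv i (ϑ t) x ^ 2 +
          l⁻¹ * FunctionSpaces.Torus.partialDeriv i (θ t) x ^ 2) / 2 :=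
      integral_mono iP iR fun x => mul_le_weighted_sq_add_sq hl _ _
    have iϑ' : Integrable (fun x => l * FunctionSpaces.Torus.partialDeriv i (ϑ t) x ^ 2) volume := iϑ.const_mul l
    have iθ' : Integrable (fun x => l⁻¹ * FunctionSpaces.Torus.partialDeriv i (θ t) x ^ 2) volume := iθ.const_mul l⁻¹
    rw [integral_div, integral_add iϑ' iθ', integral_const_mul, integral_const_mul] at hmono
    exact hmono
  nlinarith [hP, mul_nonneg hκ hG]

/-- **Viscous solutions stay `L²`-close to inviscid ones while the inviscid dissipation is
small** (integrated DEIJ balance): for `κ ≥ 0` and `[a, b] ⊆ S`,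
`‖θ(b) - ϑ(b)‖²_{L²} ≤ ‖θ(a) - ϑ(a)‖²_{L²} + ½ κ∫ₐᵇ‖∇ϑ(t)‖²_{L²} dt`.
[cite: DrivasEtAl2022, §2.1, proof of Prop. 1.3, first display] -/
theorem scalarL2Sq_sub_le_add_half_scalarDissipation (hθ : IsClassicalScalarTransportOn S κ u θ)
    (hϑ : IsClassicalScalarTransportOn S 0 u ϑ) (hκ : 0 ≤ κ) {a b : ℝ} (hab : a ≤ b)
    (hS : Icc a b ⊆ S) :
    scalarL2Sq (fun x => θ b x - ϑ b x) ≤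
      scalarL2Sq (fun x => θ a x - ϑ a x) + 1 / 2 * scalarDissipation κ ϑ a b := by
  rcases eq_or_lt_of_le hab with rfl | hab'
  · simp [scalarDissipation]
  have hθ' := hθ.restrict_Icc hab' hS
  have hϑ' := hϑ.restrict_Icc hab' hS
  have hconv : Convex ℝ (Icc a b) := convex_Icc a b
  have hU : UniqueDiffOn ℝ (Icc a b) := uniqueDiffOn_Icc hab'
  -- the balance on `[a, b]` and continuity of its right-hand side
  set D : ℝ → ℝ := fun t => 2 * κ * ((∑ i, ∫ x, FunctionSpaces.Torus.partialDeriv i (ϑ t) x *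
      FunctionSpaces.Torus.partialDeriv i (θ t) x) - scalarGradNormSq (θ t)) with hD
  have hderiv : ∀ t ∈ Icc a b, HasDerivWithinAt (fun s => scalarL2Sq (fun x => θ s x - ϑ s x)) (D t) (Icc a b) t :=
    fun t ht => hasDerivWithinAt_scalarL2Sq_sub hθ' hϑ' hconv ht
  have hPc : ContinuousOn (fun t => ∑ i, ∫ x, FunctionSpaces.Torus.partialDeriv i (ϑ t) x *
      FunctionSpaces.Torus.partialDeriv i (θ t) x) (Icc a b) :=
    continuousOn_finsetSum _ fun i _ =>
      ((hϑ'.smooth_scalar.partialDeriv hU i).mul (hθ'.smooth_scalar.partialDeriv hU i)).continuousOn_integral hconv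
  have hGθc : ContinuousOn (fun t => scalarGradNormSq (θ t)) (Icc a b) := hθ'.continuousOn_scalarGradNormSq hconv hU
  have hGϑc : ContinuousOn (fun t => scalarGradNormSq (ϑ t)) (Icc a b) := hϑ'.continuousOn_scalarGradNormSq hconv hU
  have hDc : ContinuousOn D (Icc a b) := (hPc.sub hGθc).const_smul (2 * κ) |>.congr fun t _ => by
    simp [hD, smul_eq_mul]
  have hDi : IntervalIntegrable D volume a b := (hDc.mono (uIcc_of_le hab).subset).intervalIntegrable
  have hGϑi : IntervalIntegrable (fun t => κ / 2 * scalarGradNormSq (ϑ t)) volume a b :=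
    ((hGϑc.mono (uIcc_of_le hab).subset).intervalIntegrable).const_mul _
  -- fundamental theorem of calculus and monotonicity of the integral
  have hFTC : ∫ t in a..b, D t = scalarL2Sq (fun x => θ b x - ϑ b x) - scalarL2Sq (fun x => θ a x - ϑ a x) :=
    intervalIntegral.integral_eq_sub_of_hasDerivAt_of_le hab
      (fun t ht => (hderiv t ht).continuousWithinAt)
      (fun t ht => (hderiv t (Ioo_subset_Icc_self ht)).hasDerivAt (Icc_mem_nhds ht.1 ht.2)) hDi
  have hmono : ∫ t in a..b, D t ≤ ∫ t in a..b, κ / 2 * scalarGradNormSq (ϑ t) :=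
    intervalIntegral.integral_mono_on hab hDi hGϑi fun t ht => two_mul_mul_sum_integral_sub_le hθ' hϑ' hκ ht
  have hR : ∫ t in a..b, κ / 2 * scalarGradNormSq (ϑ t) = κ / 2 * ∫ t in a..b, scalarGradNormSq (ϑ t) :=
    intervalIntegral.integral_const_mul _ _
  have key := (hFTC.symm.le.trans hmono).trans_eq hR
  simp only [scalarDissipation]
  linarith

/-- Weighted form: for `κ ≥ 0`, `[a, b] ⊆ S` and every `λ > 0`,
`‖θ(b) - ϑ(b)‖²_{L²} ≤ ‖θ(a) - ϑ(a)‖²_{L²} + λ κ∫ₐᵇ‖∇ϑ‖² + λ⁻¹ κ∫ₐᵇ‖∇θ‖²`; for equal data the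
choice `λ = (κ∫‖∇θ‖² / κ∫‖∇ϑ‖²)^{1/2}` gives DEIJ's
`‖θ - ϑ‖²(b) ≤ 2 (κ∫‖∇θ‖²)^{1/2} (κ∫‖∇ϑ‖²)^{1/2}`.
[cite: DrivasEtAl2022, §2.1, proof of Prop. 1.3, first display] -/
theorem scalarL2Sq_sub_le_of_forall_pos (hθ : IsClassicalScalarTransportOn S κ u θ)
    (hϑ : IsClassicalScalarTransportOn S 0 u ϑ) (hκ : 0 ≤ κ) {a b : ℝ} (hab : a ≤ b)
    (hS : Icc a b ⊆ S) {l : ℝ} (hl : 0 < l) :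
    scalarL2Sq (fun x => θ b x - ϑ b x) ≤
      scalarL2Sq (fun x => θ a x - ϑ a x) + l * scalarDissipation κ ϑ a b + l⁻¹ * scalarDissipation κ θ a b := by
  rcases eq_or_lt_of_le hab with rfl | hab'
  · simp [scalarDissipation]
  have hθ' := hθ.restrict_Icc hab' hS
  have hϑ' := hϑ.restrict_Icc hab' hS
  have hconv : Convex ℝ (Icc a b) := convex_Icc a b
  have hU : UniqueDiffOn ℝ (Icc a b) := uniqueDiffOn_Icc hab'
  set D : ℝ → ℝ := fun t => 2 * κ * ((∑ i, ∫ x, FunctionSpaces.Torus.partialDeriv i (ϑ t) x *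
      FunctionSpaces.Torus.partialDeriv i (θ t) x) - scalarGradNormSq (θ t)) with hD
  have hderiv : ∀ t ∈ Icc a b, HasDerivWithinAt (fun s => scalarL2Sq (fun x => θ s x - ϑ s x)) (D t) (Icc a b) t :=
    fun t ht => hasDerivWithinAt_scalarL2Sq_sub hθ' hϑ' hconv ht
  have hPc : ContinuousOn (fun t => ∑ i, ∫ x, FunctionSpaces.Torus.partialDeriv i (ϑ t) x *
      FunctionSpaces.Torus.partialDeriv i (θ t) x) (Icc a b) :=
    continuousOn_finsetSum _ fun i _ =>
      ((hϑ'.smooth_scalar.partialDeriv hU i).mul (hθ'.smooth_scalar.partialDeriv hU i)).continuousOn_integral hconv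
  have hGθc : ContinuousOn (fun t => scalarGradNormSq (θ t)) (Icc a b) := hθ'.continuousOn_scalarGradNormSq hconv hU
  have hGϑc : ContinuousOn (fun t => scalarGradNormSq (ϑ t)) (Icc a b) := hϑ'.continuousOn_scalarGradNormSq hconv hU
  have hDc : ContinuousOn D (Icc a b) := (hPc.sub hGθc).const_smul (2 * κ) |>.congr fun t _ => by
    simp [hD, smul_eq_mul]
  have hDi : IntervalIntegrable D volume a b := (hDc.mono (uIcc_of_le hab).subset).intervalIntegrable
  have hGθi : IntervalIntegrable (fun t => scalarGradNormSq (θ t)) volume a b :=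
    (hGθc.mono (uIcc_of_le hab).subset).intervalIntegrable
  have hGϑi : IntervalIntegrable (fun t => scalarGradNormSq (ϑ t)) volume a b :=
    (hGϑc.mono (uIcc_of_le hab).subset).intervalIntegrable
  have hRi : IntervalIntegrable (fun t => κ * (l * scalarGradNormSq (ϑ t) + l⁻¹ * scalarGradNormSq (θ t))) volume a b :=
    ((hGϑi.const_mul l).add (hGθi.const_mul l⁻¹)).const_mul κ
  have hFTC : ∫ t in a..b, D t = scalarL2Sq (fun x => θ b x - ϑ b x) - scalarL2Sq (fun x => θ a x - ϑ a x) :=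
    intervalIntegral.integral_eq_sub_of_hasDerivAt_of_le hab
      (fun t ht => (hderiv t ht).continuousWithinAt)
      (fun t ht => (hderiv t (Ioo_subset_Icc_self ht)).hasDerivAt (Icc_mem_nhds ht.1 ht.2)) hDi
  have hmono : ∫ t in a..b, D t ≤ ∫ t in a..b, κ * (l * scalarGradNormSq (ϑ t) + l⁻¹ * scalarGradNormSq (θ t)) :=
    intervalIntegral.integral_mono_on hab hDi hRi fun t ht =>
      two_mul_mul_sum_integral_sub_le_weighted hθ' hϑ' hκ hl ht
  have hGϑi' : IntervalIntegrable (fun t => l * scalarGradNormSq (ϑ t)) volume a b := hGϑi.const_mul l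
  have hGθi' : IntervalIntegrable (fun t => l⁻¹ * scalarGradNormSq (θ t)) volume a b := hGθi.const_mul l⁻¹
  have hR : ∫ t in a..b, κ * (l * scalarGradNormSq (ϑ t) + l⁻¹ * scalarGradNormSq (θ t)) =
      κ * (l * ∫ t in a..b, scalarGradNormSq (ϑ t)) + κ * (l⁻¹ * ∫ t in a..b, scalarGradNormSq (θ t)) := by
    rw [intervalIntegral.integral_const_mul, intervalIntegral.integral_add hGϑi' hGθi',
      intervalIntegral.integral_const_mul, intervalIntegral.integral_const_mul, mul_add]
  have key := (hFTC.symm.le.trans hmono).trans_eq hR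
  simp only [scalarDissipation]
  nlinarith [key]

end IsClassicalScalarTransportOn

end Torus

end Literature.Analysis.FluidPDE
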